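import Literature.RepresentationTheory.CompactGroups.MaximalTorusCentralizer
import Literature.RepresentationTheory.CompactGroups.CompactMatrixGroupAlgebraic
import Literature.RepresentationTheory.CompactGroups.UnitaryPointsZariskiDense
import Literature.RepresentationTheory.CompactGroups.ZariskiClosureUnitary
import Literature.RepresentationTheory.CompactGroups.MaximalConnectedAbelian
import Literature.NumberTheory.Automorphic.CentralizerTorusConnected
import Literature.NumberTheory.Automorphic.TorusTorsion
import HarnessLib

/-!
# A compact connected linear group has an element with abelian centraliser (`ExistsAbelianCentralizer`)

Topic `RepresentationTheory/CompactGroups`. Discharge of the named fact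
`Literature.RepresentationTheory.CompactGroups.ExistsAbelianCentralizer` of
`MaximalTorusCentralizer.lean` (Bröcker–tom Dieck IV (2.3)(i) with I (4.13): a generator of a
maximal torus of a compact connected Lie group has abelian centraliser), stated in the tree's
linear form — a compact connected topological group with a faithful continuous unitary matrix
representation has an element whose centraliser is abelian — and used by the `SmallCircleAnchor`
route of the Yang–Mills summit (abelianising deformations). All proved:

* `exists_comm_centralizer_of_compact_connected_unitary` — a compact connected subgroup
  `H ≤ GL_N(ℂ)` of unitary matrices contains `t` such that any two elements of `H` commuting with
  `t` commute;
* `ExistsAbelianCentralizer_holds : ExistsAbelianCentralizer`.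

## The proof (no conjugacy theorem for maximal tori)

Let `A ≤ H` be a maximal connected commutative subgroup (Zorn, `MaximalConnectedAbelian`).
1. *Lie side.* By von Neumann's exponential chart of the compact linear group `Z_H(A)`
   (`Literature.Analysis.Calculus.ClosedSubgroupExpChart`), `A` is open in `Z_H(A)`, so finitely
   many translates `f A` cover `Z_H(A)` (`exists_finset_smul_cover_of_maximal`).
2. *Algebraic side.* In the tree's concrete theory of linear algebraic groups over `ℂ`
   (`Literature.NumberTheory.Automorphic`), the Zariski closure `Ḡ` of the connected `H` is
   Zariski connected, the closure `S = Ā` is a torus, both are self-adjoint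
   (`ZariskiClosureUnitary`), and `M = Z_Ḡ(S)` is Zariski connected by Springer 6.4.7 (i)
   (`isZConnected_centralizer_torus_holds`, proved in the tree via Borel's fixed point theorem).
3. *Bridge.* Chevalley's theorem (`CompactMatrixGroupAlgebraic`): the unitary points of `Ḡ` are
   exactly `H`; hence the unitary points of `M` lie in `Z_H(A) ⊆ ⋃ f S`. The unitary points of
   the self-adjoint algebraic group `M` are Zariski dense (`UnitaryPointsZariskiDense`, the
   algebraic polar decomposition), so `M ⊆ ⋃ f S`: `S` has finite index in the connected `M`,
   `M = S` is commutative, and so is `Z_H(A) ≤ M`.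
4. A generic `t ∈ A` (`exists_generic_mem`: avoid the finitely many nowhere dense subgroups
   `{χ_i = χ_j}` of the connected `A`) has `Z_H(t) = Z_H(A)`, which is abelian; pull back along
   the faithful representation.

## References

* T. Bröcker, T. tom Dieck, *Representations of Compact Lie Groups*, GTM 98 (1985), IV (2.3),
  I (4.13) [BrockerTomDieck1985].
* C. Chevalley, *Theory of Lie Groups I* (1946), Ch. VI; A. L. Onishchik, E. B. Vinberg, *Lie
  Groups and Algebraic Groups* (1990), Ch. 5 §2; T. A. Springer, *Linear Algebraic Groups* (1998),
  6.4.7; J. von Neumann, Math. Z. 30 (1929).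
-/

noncomputable section

namespace Literature.RepresentationTheory.CompactGroups

open Literature.NumberTheory.Automorphic
open scoped Pointwise

universe u

/-- **A compact connected group of unitary matrices has a generic element: its centraliser is
commutative.** Let `H ≤ GL_N(ℂ)` be compact and connected (Euclidean topology) and contained in
`U(N)`. Then there is `t ∈ H` such that any two elements of `H` commuting with `t` commute with
each other. Proof: let `A ≤ H` be a maximal connected commutative subgroup
(`exists_maximal_connected_comm_subgroup`); by the exponential chart its centraliser `Z_H(A)` is
covered by finitely many translates `f A` (`exists_finset_smul_cover_of_maximal`). The Zariski
closure `S = Ā` is a torus inside the Zariski-connected `Ḡ = H̄` (`ZariskiClosureUnitary`), so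
`M = Z_Ḡ(S)` is Zariski connected (tree: Springer 6.4.7 (i), `isZConnected_centralizer_torus_holds`)
and self-adjoint; its unitary elements lie in `H` (Chevalley, `CompactMatrixGroupAlgebraic`), hence
in `Z_H(A) ⊆ ⋃ f S`, so by Zariski density of the unitary points (`UnitaryPointsZariskiDense`)
`M ⊆ ⋃ f S`, i.e. `S` has finite index in `M`, whence `M = S` is commutative and so is
`Z_H(A) ≤ M`. Finally a generic `t ∈ A` (`exists_generic_mem`) has `Z_H(t) = Z_H(A)`.
(Bröcker–tom Dieck IV (2.3) for compact Lie groups, here without the conjugacy theorem.)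
[cite: BrockerTomDieck1985, IV (2.3)(i) and I (4.13)] -/
theorem exists_comm_centralizer_of_compact_connected_unitary {N : ℕ} {H : Subgroup (GL (Fin N) ℂ)}
    (hHc : IsCompact (H : Set (GL (Fin N) ℂ))) (hHconn : IsConnected (H : Set (GL (Fin N) ℂ)))
    (hHU : ∀ h ∈ H, (h : Matrix (Fin N) (Fin N) ℂ) ∈ Matrix.unitaryGroup (Fin N) ℂ) :
    ∃ t ∈ H, ∀ a ∈ H, ∀ b ∈ H, a * t = t * a → b * t = t * b → a * b = b * a := by
  classical
  -- a maximal connected commutative subgroup `A ≤ H`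
  obtain ⟨A, hAH, hAconn, hAcomm, hmax⟩ := exists_maximal_connected_comm_subgroup H
  haveI hAci : IsMulCommutative A := ⟨⟨fun a b => Subtype.ext (hAcomm a a.2 b b.2)⟩⟩
  have hAU : ∀ a ∈ A, (a : Matrix (Fin N) (Fin N) ℂ) ∈ Matrix.unitaryGroup (Fin N) ℂ :=
    fun a ha => hHU a (hAH ha)
  -- finitely many translates of `A` cover `Z_H(A)`
  obtain ⟨F, -, hFcov⟩ := exists_finset_smul_cover_of_maximal hHc hAH hAconn hAcomm hmax
  -- the algebraic side: `Ḡ`, the torus `S = Ā`, and `M = Z_Ḡ(S)`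
  set G' : Subgroup (GL (Fin N) ℂ) := zariskiClosure H with hG'def
  set S : Subgroup (GL (Fin N) ℂ) := zariskiClosure A with hSdef
  have hG'conn : IsZConnected G' := isZConnected_zariskiClosure_of_isPreconnected hHconn.isPreconnected
  have hStorus : IsTorusSubgroup S := isTorusSubgroup_zariskiClosure hAconn.isPreconnected hAU
  have hSG' : S ≤ G' := zariskiClosure_mono hAH
  set M : Subgroup (GL (Fin N) ℂ) := G' ⊓ Subgroup.centralizer (S : Set (GL (Fin N) ℂ)) with hMdef
  have hMconn : IsZConnected M := isZConnected_centralizer_torus_holds hG'conn hSG' hStorus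
  have hMalg : IsAlgebraicSubgroup M :=
    (isAlgebraicSubgroup_zariskiClosure H).inf (isAlgebraicSubgroup_centralizer_set _)
  -- self-adjointness
  have hHstar : ∀ h ∈ H, star h ∈ H := fun h hh => by
    rw [star_eq_inv_of_mem_unitaryGroup (hHU h hh)]; exact H.inv_mem hh
  have hAstar : ∀ a ∈ A, star a ∈ A := fun a ha => by
    rw [star_eq_inv_of_mem_unitaryGroup (hAU a ha)]; exact A.inv_mem ha
  have hSstar : ∀ s ∈ S, star s ∈ S := fun s hs => star_mem_zariskiClosure hAstar hs
  have hMstar : ∀ m ∈ M, star m ∈ M := fun m hm =>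
    ⟨star_mem_zariskiClosure hHstar hm.1, star_mem_centralizer hSstar hm.2⟩
  -- `A ≤ S ≤ M`
  have hAS : A ≤ S := le_zariskiClosure A
  haveI hSci : IsMulCommutative S := hStorus.2.1
  have hSM : S ≤ M := fun s hs =>
    ⟨hSG' hs, Subgroup.mem_centralizer_iff.2 fun x hx =>
      congrArg Subtype.val (hSci.is_comm.comm (⟨x, hx⟩ : S) ⟨s, hs⟩)⟩
  -- the unitary elements of `M` lie in `⋃ f • S`
  set K : Subgroup (GL (Fin N) ℂ) := H ⊓ Subgroup.centralizer (A : Set (GL (Fin N) ℂ)) with hKdef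
  have hMU : ∀ m ∈ M, (m : Matrix (Fin N) (Fin N) ℂ) ∈ Matrix.unitaryGroup (Fin N) ℂ →
      m ∈ ⋃ f ∈ F, f • (S : Set (GL (Fin N) ℂ)) := by
    intro m hm hmU
    have hmH : m ∈ H := mem_of_mem_zariskiClosure_of_mem_unitaryGroup hHc hHU hm.1 hmU
    have hmK : m ∈ K := ⟨hmH, Subgroup.centralizer_le (SetLike.coe_subset_coe.2 hAS) hm.2⟩
    obtain ⟨f, hf, hmf⟩ := hFcov m hmK
    exact Set.mem_iUnion₂.2 ⟨f, hf, Set.smul_set_mono (SetLike.coe_subset_coe.2 hAS) hmf⟩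
  -- hence `M ⊆ ⋃ f • S` by Zariski density of the unitary points
  obtain ⟨T, hT⟩ := exists_zeroLocusGL_eq_biUnion_smul (isAlgebraicSubgroup_zariskiClosure A) F
  have hMsub : (M : Set (GL (Fin N) ℂ)) ⊆ ⋃ f ∈ F, f • (S : Set (GL (Fin N) ℂ)) := by
    rw [hT]
    exact subset_zeroLocusGL_of_unitary_mem hMalg hMstar T fun m hm hmU => hT ▸ hMU m hm hmU
  -- so `S` has finite index in `M`, and `M = S` by Zariski connectedness
  haveI : Finite (M ⧸ S.subgroupOf M) := by
    have key : ∀ q : M ⧸ S.subgroupOf M, ∃ f ∈ F,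
        ((Quotient.out q : M) : GL (Fin N) ℂ) ∈ f • (S : Set (GL (Fin N) ℂ)) := fun q => by
      simpa only [Set.mem_iUnion, exists_prop] using hMsub (Quotient.out q).2
    choose φ hφF hφ using key
    refine Finite.of_injective (fun q => (⟨φ q, hφF q⟩ : F)) fun q₁ q₂ h => ?_
    have hf : φ q₁ = φ q₂ := congrArg Subtype.val h
    obtain ⟨s₁, hs₁, h₁⟩ := Set.mem_smul_set.1 (hφ q₁)
    obtain ⟨s₂, hs₂, h₂⟩ := Set.mem_smul_set.1 (hφ q₂)
    rw [← QuotientGroup.out_eq' q₁, ← QuotientGroup.out_eq' q₂, QuotientGroup.eq, Subgroup.mem_subgroupOf,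
      Subgroup.coe_mul, Subgroup.coe_inv, ← h₁, ← h₂, hf, smul_eq_mul, smul_eq_mul, mul_inv_rev,
      mul_assoc, inv_mul_cancel_left]
    exact S.mul_mem (S.inv_mem hs₁) hs₂
  have hMS : M = S :=
    (hMconn.2 S hSM (isAlgebraicSubgroup_zariskiClosure A) Subgroup.finiteIndex_of_finite_quotient).symm
  -- `Z_H(A) ≤ M = S` is commutative
  have hKM : K ≤ M := by
    intro k hk
    refine ⟨le_zariskiClosure H hk.1, Subgroup.mem_centralizer_iff.2 fun s hs => ?_⟩
    have hAk : A ≤ Subgroup.centralizer {k} := fun a ha =>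
      Subgroup.mem_centralizer_iff.2 fun x hx => by
        rw [Set.mem_singleton_iff.1 hx]
        exact ((Subgroup.mem_centralizer_iff.1 hk.2) a ha).symm
    have hSk : S ≤ Subgroup.centralizer {k} :=
      zariskiClosure_le (isAlgebraicSubgroup_centralizer_set _) hAk
    exact ((Subgroup.mem_centralizer_iff.1 (hSk hs)) k rfl).symm
  have hKcomm : ∀ x ∈ K, ∀ y ∈ K, x * y = y * x := by
    intro x hx y hy
    have hx' : x ∈ S := hMS ▸ hKM hx
    have hy' : y ∈ S := hMS ▸ hKM hy
    exact congrArg Subtype.val (hSci.is_comm.comm (⟨x, hx'⟩ : S) ⟨y, hy'⟩)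
  -- a generic element of `A`
  obtain ⟨t, htA, hgen⟩ := exists_generic_mem hAconn
    (fun a ha => isSemisimpleElt_of_mem_unitaryGroup (hAU a ha))
  refine ⟨t, hAH htA, fun a ha b hb hat hbt => hKcomm a ⟨ha, ?_⟩ b ⟨hb, ?_⟩⟩
  · exact Subgroup.mem_centralizer_iff.2 fun x hx => (hgen a hat x hx).symm
  · exact Subgroup.mem_centralizer_iff.2 fun x hx => (hgen b hbt x hx).symm

/-- **A compact connected linear group has an element with abelian centraliser** — a second,
independent proof of the named fact `ExistsAbelianCentralizer` of `MaximalTorusCentralizer.lean`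
(Bröcker–tom Dieck IV (2.3)(i) with I (4.13); the tree's primary discharge is
`ExistsAbelianCentralizer_holds` in `MaximalTorusCentralizerProofs.lean`, via reductivity of the
Zariski closure and regular elements of a maximal torus). Here: apply
`exists_comm_centralizer_of_compact_connected_unitary` to the compact connected unitary group
`ρ(G) ≤ GL_N(ℂ)` and pull back along the injective `ρ`; the ingredients are von Neumann's
exponential chart, Chevalley's algebraicity of compact linear groups, the Zariski density of the
unitary points of a self-adjoint algebraic group, and the connectedness of centralisers of tori
(Springer 6.4.7 (i)). [cite: BrockerTomDieck1985, IV (2.3)(i) and I (4.13)] -/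
theorem existsAbelianCentralizer_via_chevalley : ExistsAbelianCentralizer.{u} := by
  intro G _ _ _ _ _ N ρ hρc hρi hρu
  classical
  -- the continuous injective homomorphism `G → GL_N(ℂ)` through `U(N)`
  let φ : G →* GL (Fin N) ℂ :=
    Unitary.toUnits.comp (ρ.codRestrict (Matrix.unitaryGroup (Fin N) ℂ) hρu)
  have hφval : ∀ g, ((φ g : GL (Fin N) ℂ) : Matrix (Fin N) (Fin N) ℂ) = ρ g := fun g => rfl
  have hφc : Continuous φ := by
    refine Units.continuous_iff.2 ⟨?_, ?_⟩
    · exact hρc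
    · change Continuous fun g => star (ρ g)
      exact hρc.star
  have hφi : Function.Injective φ := fun a b h =>
    hρi (by rw [← hφval, ← hφval, h])
  have hHc : IsCompact ((φ.range : Subgroup (GL (Fin N) ℂ)) : Set (GL (Fin N) ℂ)) :=
    isCompact_range hφc
  have hHconn : IsConnected ((φ.range : Subgroup (GL (Fin N) ℂ)) : Set (GL (Fin N) ℂ)) :=
    isConnected_range hφc
  have hHU : ∀ h ∈ φ.range, (h : Matrix (Fin N) (Fin N) ℂ) ∈ Matrix.unitaryGroup (Fin N) ℂ := by
    rintro _ ⟨g, rfl⟩; exact hρu g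
  obtain ⟨t, ⟨g₀, rfl⟩, ht⟩ := exists_comm_centralizer_of_compact_connected_unitary hHc hHconn hHU
  refine ⟨g₀, fun a b ha hb => hφi ?_⟩
  rw [map_mul, map_mul]
  exact ht (φ a) ⟨a, rfl⟩ (φ b) ⟨b, rfl⟩ (by rw [← map_mul, ha, map_mul])
    (by rw [← map_mul, hb, map_mul])

end Literature.RepresentationTheory.CompactGroups

end
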